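import Literature.NumberTheory.EllipticCurves.BurungaleKobayashiOta2024.SupersingularPConverse
import Literature.NumberTheory.EllipticCurves.ComplexMultiplicationHasCMProofs
import Literature.NumberTheory.EllipticCurves.MordellCurveSupersingular

set_option linter.dupNamespace false
set_option autoImplicit false

/-!
# Route `MordellShaFreeCut` (rung S2b) — the BC5 rung of crux `AnalyticRankOneOfRankOneFiniteShaThree`
# in the sibling supersingular setting

The crux is the Ш-finite 3-converse `rank E_D(ℚ) = 1 ∧ #Ш(E_D/ℚ)[3^∞] < ∞ ⟹ ord_{s=1} L(E_D, s) = 1`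
for the Mordell curves `E_D : y² = x³ + D` at the RAMIFIED CM prime `3` of `ℚ(√−3)`. Its analogue
with `3` replaced by a good SUPERSINGULAR prime `p ≥ 5` of the same curves — every `p ≡ 2 (mod 3)`,
`p ∤ D`, since `a_p(E_D) = 0` there (Ireland–Rosen Ch. 18 §3 Thm. 4; tree theorem
`Literature.NumberTheory.EllipticCurves.frobeniusTrace_mordellCurve_eq_zero`), i.e. the primes
INERT in `ℚ(√−3)` — is decided in print by Burungale–Kobayashi–Ota, JIMJ 23 (2024) Thm. 1.5 (tree
fact `BurungaleKobayashiOta2024.thm15_analyticRank_eq_one_of_selmerCorank_eq_one`, taken here as the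
named hypothesis `hBKO`; its `HasCM` form
`BurungaleKobayashiOta2024.analyticRank_eq_one_of_mordellWeilRank_eq_one_of_finite_sha_primary`).
This file is the `E_D` twin of the `E_n` rung recorded for route `CongruentShaFreeCut`
(planner note `AnalyticRankOneOfRankOneFiniteShaThree_rung.md`, cell bsd-cn100): it specialises the
tree theorem to `mordellCurve (D : ℚ)`, `D : ℤ`, on the hypothesis that this Weierstrass equation is
globally minimal (true e.g. for sixth-power-free `D` with `E_D` minimal at `2` and `3`; the tree's
invariants `frobeniusTrace` / `reductionPointCount` are attached to global minimal models), using
`hasCM_of_j_eq_zero` (`j(E_D) = 0`), `hasGoodReductionAtPrime_mordellCurve` (`p ∤ 6D`) and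
`frobeniusTrace_mordellCurve_eq_zero` (`a_p = 0`). It SUPPORTS item
`AnalyticRankOneOfRankOneFiniteShaThree` (stmt-BirchSwinnertonDyer-19160) as its first rung — the main
theorem is named and typed EXACTLY as the stub `stub_rung_supersingular` registered on that item
(skeleton sha f9a75e4a, plan g8), so it lands with `--supports stmt-BirchSwinnertonDyer-19160`; it does
not close it (the leaf's prime `3` is ramified, outside BKO's inert regime). Conditional on `hBKO`
exactly as the `E_n` rung is. Authors: transfer g3 (proof, refereed read2-tr-2) + plan g8 (stub naming).
-/

namespace Summit.BirchSwinnertonDyer.BirchSwinnertonDyer.Theorems.MordellShaFreeCutRungSupersingular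

open Literature.NumberTheory.EllipticCurves WeierstrassCurve

/-- For a globally minimal Mordell equation `E_D : y² = x³ + D` (`D : ℤ`), the tree's integral model
of `mordellCurve (D : ℚ)` is `mordellCurve D` over `ℤ` (uniqueness of lifts along `ℤ → ℚ`).
[folklore] -/
theorem integralModelInt_mordellCurve (D : ℤ) [(mordellCurve (D : ℚ)).IsGloballyMinimal] :
    integralModelInt (mordellCurve (D : ℚ)) = mordellCurve D := by
  apply WeierstrassCurve.map_injective (f := Int.castRingHom ℚ) Int.cast_injective
  simp only [map_integralModelInt, map_mordellCurve, eq_intCast]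

/-- For a globally minimal `E_D` (`D : ℤ`), the tree's trace of Frobenius of the global minimal model
at `p` is `p + 1 − #Ẽ_D(𝔽_p)` computed on `y² = x³ + D` itself,
`Literature.NumberTheory.Automorphic.frobeniusTrace (mordellCurve D) p`. [folklore] -/
theorem frobeniusTrace_mordellCurve (D : ℤ) (p : ℕ) [(mordellCurve (D : ℚ)).IsGloballyMinimal] :
    frobeniusTrace (mordellCurve (D : ℚ)) p =
      Literature.NumberTheory.Automorphic.frobeniusTrace (mordellCurve D) p := by
  rw [frobeniusTrace, reductionPointCount, integralModelInt_mordellCurve,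
    Literature.NumberTheory.Automorphic.frobeniusTrace, Literature.NumberTheory.Automorphic.numPointsMod]

/-- **Rung (BC5) for `AnalyticRankOneOfRankOneFiniteShaThree`** — the crux of route
`MordellShaFreeCut` with the ramified prime `3` replaced by any good supersingular prime `p ≥ 5`
(`p ≡ 2 (mod 3)`, `p ∤ D`) of the Mordell curve `E_D : y² = x³ + D` (`D : ℤ`, the equation globally
minimal), granted Burungale–Kobayashi–Ota 2024 Thm. 1.5 as printed (`hBKO`):
`rank E_D(ℚ) = 1 ∧ #Ш(E_D/ℚ)[p^∞] < ∞ ⟹ ord_{s=1} L(E_D, s) = 1`. Inputs: `j(E_D) = 0` so `E_D`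
has CM (`hasCM_of_j_eq_zero`); good reduction at `p ∤ 6D` (`hasGoodReductionAtPrime_mordellCurve`);
`a_p(E_D) = 0` at `p ≡ 2 (mod 3)` (`frobeniusTrace_mordellCurve_eq_zero`, Ireland–Rosen Ch. 18 §3
Thm. 4). -/
theorem stub_rung_supersingular
    (hBKO : BurungaleKobayashiOta2024.thm15_analyticRank_eq_one_of_selmerCorank_eq_one)
    {D : ℤ} (hD : D ≠ 0) [(mordellCurve (D : ℚ)).IsGloballyMinimal] {p : ℕ} [Fact p.Prime]
    (hp : 5 ≤ p) (hp3 : p % 3 = 2) (hpD : ¬ (p : ℤ) ∣ D)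
    (hrank : (mordellCurve (D : ℚ)).mordellWeilRank = 1)
    (hsha : Finite (AddCommGroup.primaryComponent (mordellCurve (D : ℚ)).sha p)) :
    (mordellCurve (D : ℚ)).analyticRank = 1 := by
  have hpP : p.Prime := Fact.out
  have hDQ : (D : ℚ) ≠ 0 := by exact_mod_cast hD
  haveI := isElliptic_mordellCurve hDQ
  have hp2 : p ≠ 2 := by omega
  have hp3' : p ≠ 3 := by omega
  have hp6D : ¬ (p : ℤ) ∣ 6 * D := by
    intro h
    have hp' : Prime (p : ℤ) := Nat.prime_iff_prime_int.mp hpP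
    rcases hp'.dvd_or_dvd h with h6 | hD'
    · have h6' : p ∣ 6 := by exact_mod_cast h6
      have : p ≤ 6 := Nat.le_of_dvd (by norm_num) h6'
      interval_cases p <;> simp_all (config := {decide := true})
    · exact hpD hD'
  have hgood : (mordellCurve (D : ℚ)).HasGoodReductionAtPrime p :=
    hasGoodReductionAtPrime_mordellCurve hp6D
  have hss : (p : ℤ) ∣ (mordellCurve (D : ℚ)).frobeniusTrace p := by
    rw [frobeniusTrace_mordellCurve, frobeniusTrace_mordellCurve_eq_zero hpP hp3 hp2 hpD]
    exact dvd_zero _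
  have hCM : (mordellCurve (D : ℚ)).HasCM :=
    WeierstrassCurve.hasCM_of_j_eq_zero _ ((mordellCurve (D : ℚ)).j_eq_zero (mordellCurve_c₄ _))
  exact BurungaleKobayashiOta2024.analyticRank_eq_one_of_mordellWeilRank_eq_one_of_finite_sha_primary
    hBKO _ hCM p hp hgood hss hrank hsha

end Summit.BirchSwinnertonDyer.BirchSwinnertonDyer.Theorems.MordellShaFreeCutRungSupersingular
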